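import Literature.NumberTheory.DiophantineGeometry.AbcValuationProduct
import Literature.NumberTheory.DiophantineGeometry.FaltingsHeight
import Literature.NumberTheory.DiophantineGeometry.Conductor
import HarnessLib

/-!
# Subexponential Szpiro in one-parameter families, and the valuation-product criterion for radicals
# of polynomial values (Cuevas Barrientos–Pasten 2025)

Topic `Literature/NumberTheory/DiophantineGeometry` (family `abc`, LADDER-ABC A1 / candidate column
A1′ "valuation products"; recent-theorem harvest of the cross-ladder literature-typing layer, seat
lit-abc-pasten g2). Source: J. Cuevas Barrientos, H. Pasten, *On the greatest prime factor of
polynomial values and subexponential Szpiro in families*, arXiv:2504.15971 (2025)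
[`CuevasPasten2025SubexpSzpiro`] (held text READ: §1 Thms 1.1–1.6 and Cor 1.2, §2 Thm 2.1, §4
Lemmas 4.1–4.2 and the proof of Thm 1.1). The paper combines Pasten's MODULAR approach to `abc`
(Murty–Pasten 2013 Thm 7.1 = their Thm 1.5, tree `MurtyPasten.log_minimalDiscriminant_lt` /
`MurtyPasten.height_discriminant_asymptotic_of_modularity_mazurKenku`; Pasten JNT 254, Cor 16.3 of
the journal numbering = their Thm 1.6 = tree `pastenShimura2024_cor_16_2`, products of valuations
via Shimura curves) with linear forms in logarithms (their Thm 2.1 = Evertse–Győry Thm 4.2.1) to get: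

* **Thm 1.4** (the criterion; `CuevasPasten2025_thm_1_4`, NAMED FACT): if `F ∈ ℤ[x]` has at least
  two distinct complex roots and `∏_{p ∣ F(n)} ν_p(F(n)) ≪_F rad(F(n))^μ` for some `μ > 0` and all
  but finitely many `n ∈ ℤ`, then `log|n| ≤ exp(κ √(log⁎ rad F(n) · log⁎₂ rad F(n)))` for all `n ∈ ℤ`
  and some `κ = κ(F) > 0`.
* **Thm 1.1** (`CuevasPasten2025_thm_1_1`, NAMED FACT): for `A, B ∈ ℤ[t]` coprime over `ℚ`, not both
  constant, with `D = −16(4A³ + 27B²) ≠ 0`, the fibres `E_n : y² = x³ + A(n)x + B(n)` (`n ∈ ℤ`,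
  `E_n` elliptic) satisfy `h(E_n) ≤ exp(κ √((log N_n) log⁎₂ N_n))` with `κ = κ(A, B) > 0`
  (and `log|Δ_n| ≪ h(E_n)`, Silverman — in the tree `pasten2024_log_minimalDiscriminant_le_holds`,
  not restated).
* **Cor 1.2** (`CuevasPasten2025_thm_1_1.cor_1_2`, PROVED from Thm 1.1): for every `ε > 0`,
  `h(E_n) ≪_ε N_n^ε` on the family — a SUBEXPONENTIAL bound for the height in terms of the conductor in
  one-parameter families (the previous record for all `E/ℚ` being exponential, `h(E) ≪ N_E log N_E`).

Rendering. `log⁎ t` ("the logarithm whenever it is defined and `≥ 1`, otherwise `1`") is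
`max 1 (Real.log t)` and `log⁎₂ t` is `max 1 (Real.log (Real.log t))`; both agree with the printed
convention for `t ≥ 1` (here `t` is a radical or a conductor, `≥ 1`). `rad` of an integer is Mathlib's
`UniqueFactorizationMonoid.radical` of its absolute value in `ℕ` (`rad 0 = 1`), `∏_{p∣m} ν_p(m)` is the
tree's `exponentProduct |m|` (`AbcValuationProduct.lean`). The fibre `E_n` is the Weierstrass curve
`cuevasPastenFibre A B n = ⟨0, 0, 0, A(n), B(n)⟩` over `ℚ`; "`n ∉ Σ`" (the fibre is an elliptic
curve) is the instance `[(cuevasPastenFibre A B n).IsElliptic]`; `h` is the tree's Faltings height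
`WeierstrassCurve.faltingsHeight`, `N_n = conductorNorm ℤ`; "≪_F" with `F` fixed is an existential
constant. NOT TYPED: Thm 1.3 (greatest prime factor of quadratic / cubic values — does not bear on
`abc`), Thm 2.1 (Evertse–Győry 4.2.1 over number fields; the tree has the rational case
`evertseGyory_thm_4_2_1_rat`), Prop 2.2, §3. Faithfulness sheet: Thm 1.4 FAITHFUL; Thm 1.1 FAITHFUL
for the displayed height bound (the `log|Δ_n| ≪ h(E_n)` half is Silverman's inequality, in the tree);
Cor 1.2 FAITHFUL (height half). Typed ≠ proved ≠ endorsed; no claim on `abc`.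

## References

* [CuevasPasten2025SubexpSzpiro] J. Cuevas Barrientos, H. Pasten, arXiv:2504.15971: Thm 1.1, Cor 1.2
  (§1.1), Thm 1.4, Thms 1.5–1.6 (§1.4), Thm 2.1 (§2.1), Lemmas 4.1–4.2 and proof of Thm 1.1 (§4).
* [MurtyPasten2013] M. R. Murty, H. Pasten, J. Number Theory 133 (2013), Thm 7.1 (their Thm 1.5).
* [PastenShimura2024] H. Pasten, J. Number Theory 254 (2024) = arXiv:1705.09251, Cor 16.2 of the
  arXiv text = Cor 16.3 of the journal (their Thm 1.6).
-/

noncomputable section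

open Polynomial WeierstrassCurve UniqueFactorizationMonoid

namespace Literature.NumberTheory.DiophantineGeometry

/-! ### Thm 1.4: the valuation-product criterion -/

/-- NAMED FACT — **Cuevas Barrientos–Pasten 2025, Theorem 1.4** (the main criterion: lower bounds
for radicals of polynomial values from bounds on products of valuations). *"Let `F(x) ∈ ℤ[x]` be a
polynomial with at least two different complex roots that satisfies the following property: there
exists a constant `μ := μ(F) > 0` such that for all but finitely many `n ∈ ℤ` we have
`∏_{p ∣ F(n)} ν_p(F(n)) ≪_F rad(F(n))^μ`. Then there exists a constant `κ := κ(F) > 0` such that for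
all `n ∈ ℤ` we have `log|n| ≤ exp(κ √((log⁎ rad F(n)) log⁎₂ rad F(n)))`."* Rendering: at least two
distinct complex roots = `2 ≤ #(F.map ℂ).roots.toFinset` (forces `F ≠ 0`); `∏ ν_p` =
`exponentProduct |F(n)|`, `rad` in `ℕ` of `|F(n)|`; `log⁎ = max 1 ∘ log`, `log⁎₂ = max 1 ∘ log ∘ log`
(module docstring). Printed proof: §3 (Evertse–Győry's linear forms Thm 2.1, Prop 2.2).
[cite: CuevasPasten2025SubexpSzpiro, Thm. 1.4 (§1.4)] -/
def CuevasPasten2025_thm_1_4 : Prop :=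
  ∀ (F : ℤ[X]), 2 ≤ ((F.map (Int.castRingHom ℂ)).roots.toFinset).card →
    (∃ μ : ℝ, 0 < μ ∧ ∃ C : ℝ, ∀ᶠ n : ℤ in Filter.cofinite,
        (exponentProduct (F.eval n).natAbs : ℝ) ≤
          C * (radical (M := ℕ) (F.eval n).natAbs : ℝ) ^ μ) →
      ∃ κ : ℝ, 0 < κ ∧ ∀ n : ℤ,
        Real.log |(n : ℝ)| ≤
          Real.exp (κ * Real.sqrt
            (max 1 (Real.log (radical (M := ℕ) (F.eval n).natAbs)) *
              max 1 (Real.log (Real.log (radical (M := ℕ) (F.eval n).natAbs)))))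

/-! ### Thm 1.1: subexponential Szpiro / height bound on an elliptic surface -/

/-- **The fibre `E_n : y² = x³ + A(n) x + B(n)`** of the elliptic surface of Thm 1.1 over the
integer `n` (a short Weierstrass equation over `ℚ` with integer coefficients; it is an elliptic curve
iff `4A(n)³ + 27B(n)² ≠ 0`, i.e. `n ∉ Σ`). [cite: CuevasPasten2025SubexpSzpiro, Thm. 1.1 (§1.1), display (E_t)] -/
def cuevasPastenFibre (A B : ℤ[X]) (n : ℤ) : WeierstrassCurve ℚ :=
  { a₁ := 0, a₂ := 0, a₃ := 0, a₄ := ((A.eval n : ℤ) : ℚ), a₆ := ((B.eval n : ℤ) : ℚ) }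

/-- Unfolding lemmas for the fibre. [cite: CuevasPasten2025SubexpSzpiro, Thm. 1.1 (§1.1)] -/
theorem cuevasPastenFibre_a₄ (A B : ℤ[X]) (n : ℤ) :
    (cuevasPastenFibre A B n).a₄ = ((A.eval n : ℤ) : ℚ) := rfl

/-- Unfolding lemma (`a₆`). [cite: CuevasPasten2025SubexpSzpiro, Thm. 1.1 (§1.1)] -/
theorem cuevasPastenFibre_a₆ (A B : ℤ[X]) (n : ℤ) :
    (cuevasPastenFibre A B n).a₆ = ((B.eval n : ℤ) : ℚ) := rfl

/-- The discriminant of the fibre is the classical `−16(4A(n)³ + 27B(n)²)` (so `E_n` is elliptic iff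
`D(n) ≠ 0`, `D = −16(4A³ + 27B²)`). [cite: CuevasPasten2025SubexpSzpiro, Thm. 1.1 (§1.1), the discriminant D] -/
theorem cuevasPastenFibre_Δ (A B : ℤ[X]) (n : ℤ) :
    (cuevasPastenFibre A B n).Δ = -16 * (4 * ((A.eval n : ℤ) : ℚ) ^ 3 + 27 * ((B.eval n : ℤ) : ℚ) ^ 2) := by
  simp only [cuevasPastenFibre, WeierstrassCurve.Δ, WeierstrassCurve.b₂, WeierstrassCurve.b₄,
    WeierstrassCurve.b₆, WeierstrassCurve.b₈]
  ring

/-- NAMED FACT — **Cuevas Barrientos–Pasten 2025, Theorem 1.1** (a PROVED subexponential bound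
for the Faltings height, hence for the minimal discriminant, in terms of the conductor along a
one-parameter family; a theorem in print, not a conditional statement). *"Let `A, B ∈ ℤ[t]` be
polynomials, coprime over `ℚ`, not both constant, and such that the discriminant
`D = −16(4A³ + 27B²) ∈ ℤ[t]` is not the zero polynomial. Consider the elliptic surface (on the
parameter `t`) of affine Weierstrass equation `E_t : y² = x³ + A(t) x + B(t)`. Let `Σ ⊆ ℤ` be the
finite set of integers `n` such that the fibre `E_n` is not an elliptic curve. There is a constant
`κ > 0` depending only on `A(t)` and `B(t)`, such that for every `n ∈ ℤ ∖ Σ` one has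
`log|Δ_n| ≪ h(E_n) ≤ exp(κ √((log N_n) log⁎₂ N_n))`, where `N_n` is the conductor and `Δ_n` is the
minimal discriminant of `E_n`."* Typed: the height bound (`h` = Faltings height, `N_n = N_{E_n}`,
`log⁎₂ = max 1 ∘ log ∘ log`); the first `≪` is Silverman's `log|Δ| ≤ 12 h + 16` (tree). Printed proof
(§4): quasi-minimality of the family (`gcd(A(n), B(n)) ∣ Res(A, B)`), Lemmas 4.1–4.2 (the surface is
non-isotrivial with ≥ 2 bad affine fibres), Thm 1.4 with Thm 1.5 (Murty–Pasten) and Thm 1.6 (Pasten,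
products of valuations), `h(E_n) ≍ log max{|A(n)|³, |B(n)|²} ≍ log|n|`.
[cite: CuevasPasten2025SubexpSzpiro, Thm. 1.1 (§1.1); proof §4] -/
def CuevasPasten2025_thm_1_1 : Prop :=
  ∀ (A B : ℤ[X]), IsCoprime (A.map (Int.castRingHom ℚ)) (B.map (Int.castRingHom ℚ)) →
    (0 < A.natDegree ∨ 0 < B.natDegree) → (4 * A ^ 3 + 27 * B ^ 2 ≠ 0) →
      ∃ κ : ℝ, 0 < κ ∧ ∀ (n : ℤ) [(cuevasPastenFibre A B n).IsElliptic],
        (cuevasPastenFibre A B n).faltingsHeight ≤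
          Real.exp (κ * Real.sqrt
            (Real.log ((cuevasPastenFibre A B n).conductorNorm ℤ) *
              max 1 (Real.log (Real.log ((cuevasPastenFibre A B n).conductorNorm ℤ)))))

/-! ### Cor 1.2: `h(E_n) ≪_ε N_n^ε` (PROVED from Thm 1.1) -/

/-- Real-analysis core of Cor 1.2: `κ √(L · log⁎₂) ≤ ε L + K` for `L ≥ 0`, for some `K = K(κ, ε)`
(`log L ≤ 2√L`, `√(1 + 2s) ≤ δ s + 1/δ + 1`, AM–GM). [folklore] -/
private theorem exists_sqrt_mul_logStar_le {κ ε : ℝ} (hκ : 0 < κ) (hε : 0 < ε) :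
    ∃ K : ℝ, ∀ L : ℝ, 0 ≤ L →
      κ * Real.sqrt (L * max 1 (Real.log L)) ≤ ε * L + K := by
  set δ : ℝ := ε / (2 * κ) with hδ
  have hδpos : 0 < δ := by positivity
  set u : ℝ := κ * (1 / δ + 1) with hu
  have hupos : 0 < u := by positivity
  set v : ℝ := κ * δ with hv
  have hvpos : 0 < v := by positivity
  refine ⟨u ^ 2 / (4 * v), fun L hL => ?_⟩
  set s : ℝ := Real.sqrt L with hs
  have hs0 : 0 ≤ s := Real.sqrt_nonneg L
  have hL2 : L = s ^ 2 := (Real.sq_sqrt hL).symm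
  -- `max 1 (log L) ≤ 1 + 2 s`
  have hlog : Real.log L ≤ 2 * s := by
    have h := Real.log_le_rpow_div hL (show (0 : ℝ) < 1 / 2 by norm_num)
    rw [← Real.sqrt_eq_rpow] at h
    linarith
  have hm : max 1 (Real.log L) ≤ 1 + 2 * s := max_le (by linarith) (by linarith)
  have hm0 : 0 ≤ max 1 (Real.log L) := le_trans zero_le_one (le_max_left _ _)
  -- `√(L · m) ≤ s · √(1 + 2s)`
  have h1 : L * max 1 (Real.log L) ≤ s ^ 2 * (1 + 2 * s) := by
    have h := mul_le_mul_of_nonneg_left hm hL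
    have e : L * (1 + 2 * s) = s ^ 2 * (1 + 2 * s) := by rw [hL2]
    exact h.trans e.le
  have h2 : Real.sqrt (L * max 1 (Real.log L)) ≤ s * Real.sqrt (1 + 2 * s) := by
    calc Real.sqrt (L * max 1 (Real.log L)) ≤ Real.sqrt (s ^ 2 * (1 + 2 * s)) :=
          Real.sqrt_le_sqrt h1
      _ = s * Real.sqrt (1 + 2 * s) := by
          rw [Real.sqrt_mul (sq_nonneg s), Real.sqrt_sq hs0]
  -- `√(1 + 2s) ≤ δ s + 1/δ + 1`
  have h3 : Real.sqrt (1 + 2 * s) ≤ δ * s + 1 / δ + 1 := by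
    rw [Real.sqrt_le_left (by positivity)]
    have h1δ : 1 ≤ 1 / δ + 1 := by
      have : 0 ≤ 1 / δ := by positivity
      linarith
    have hc : (δ * s + 1 / δ + 1) ^ 2 =
        δ ^ 2 * s ^ 2 + 2 * s + 2 * δ * s + (1 / δ + 1) ^ 2 := by
      field_simp; ring
    have hc1 : 1 ≤ (1 / δ + 1) ^ 2 := by nlinarith
    have hds : 0 ≤ δ * s := mul_nonneg hδpos.le hs0
    rw [hc]
    nlinarith [sq_nonneg (δ * s)]
  -- assemble: `κ s √(1+2s) ≤ κ δ s² + u s ≤ 2 κ δ s² + u²/(4 κ δ) = ε L + K`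
  have h4 : κ * Real.sqrt (L * max 1 (Real.log L)) ≤ v * s ^ 2 + u * s := by
    calc κ * Real.sqrt (L * max 1 (Real.log L)) ≤ κ * (s * Real.sqrt (1 + 2 * s)) :=
          mul_le_mul_of_nonneg_left h2 hκ.le
      _ ≤ κ * (s * (δ * s + 1 / δ + 1)) := by gcongr
      _ = v * s ^ 2 + u * s := by rw [hv, hu]; ring
  have hAMGM : u * s ≤ v * s ^ 2 + u ^ 2 / (4 * v) := by
    have h := sq_nonneg (2 * v * s - u)
    have h4v : 0 < 4 * v := by positivity
    rw [← sub_nonneg]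
    have : v * s ^ 2 + u ^ 2 / (4 * v) - u * s = (2 * v * s - u) ^ 2 / (4 * v) := by
      field_simp; ring
    rw [this]; positivity
  have hεL : 2 * v * s ^ 2 = ε * L := by
    rw [hv, hδ, hL2]; field_simp
  linarith

/-- **Cuevas Barrientos–Pasten 2025, Corollary 1.2 (the subexponential bound `h(E_n) ≪_ε N_n^ε`),
PROVED from Thm 1.1.** *"With the notation of Theorem 1.1, if `Δ_n` is the minimal discriminant of
`E_n` for `n ∈ ℤ ∖ Σ`, then for every `ε > 0` one has `log|Δ_n| ≪ h(E_n) ≪_ε N_n^ε`."* Typed: the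
height half — for every `ε > 0` there is `C = C(A, B, ε)` with `h(E_n) ≤ C · N_n^ε` for all `n ∉ Σ`
(from `exp(κ √(log N · log⁎₂ N)) ≤ e^K N^ε`, `exists_sqrt_mul_logStar_le`).
[cite: CuevasPasten2025SubexpSzpiro, Cor. 1.2 (§1.1)] -/
theorem CuevasPasten2025_thm_1_1.cor_1_2 (h : CuevasPasten2025_thm_1_1) (A B : ℤ[X])
    (hcop : IsCoprime (A.map (Int.castRingHom ℚ)) (B.map (Int.castRingHom ℚ)))
    (hnc : 0 < A.natDegree ∨ 0 < B.natDegree) (hD : 4 * A ^ 3 + 27 * B ^ 2 ≠ 0)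
    {ε : ℝ} (hε : 0 < ε) :
    ∃ C : ℝ, ∀ (n : ℤ) [(cuevasPastenFibre A B n).IsElliptic],
      (cuevasPastenFibre A B n).faltingsHeight ≤
        C * ((cuevasPastenFibre A B n).conductorNorm ℤ : ℝ) ^ ε := by
  obtain ⟨κ, hκ, hb⟩ := h A B hcop hnc hD
  obtain ⟨K, hK⟩ := exists_sqrt_mul_logStar_le hκ hε
  refine ⟨Real.exp K, fun n _ => ?_⟩
  set W := cuevasPastenFibre A B n with hW
  have hNpos : 0 < W.conductorNorm ℤ := conductorNorm_pos_holds W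
  have hN0 : (0 : ℝ) < (W.conductorNorm ℤ : ℝ) := by exact_mod_cast hNpos
  have hL : 0 ≤ Real.log (W.conductorNorm ℤ : ℝ) := Real.log_nonneg (by exact_mod_cast hNpos)
  have h1 := hb n
  have h2 := hK (Real.log (W.conductorNorm ℤ : ℝ)) hL
  calc W.faltingsHeight ≤ Real.exp (κ * Real.sqrt (Real.log (W.conductorNorm ℤ : ℝ) *
        max 1 (Real.log (Real.log (W.conductorNorm ℤ : ℝ))))) := h1
    _ ≤ Real.exp (ε * Real.log (W.conductorNorm ℤ : ℝ) + K) := Real.exp_le_exp.mpr h2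
    _ = Real.exp K * (W.conductorNorm ℤ : ℝ) ^ ε := by
        rw [Real.exp_add, Real.rpow_def_of_pos hN0, mul_comm (Real.log _) ε, mul_comm]

end Literature.NumberTheory.DiophantineGeometry

end
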